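import Summits.PneNP.PneNP.Theorems.ConvexRankGatesLinAlgGateBlindLevelHost
import Summits.PneNP.PneNP.Theorems.ConvexRankGatesLinAlgGateBlindDoorHost
import Summits.PneNP.PneNP.Theorems.ConvexRankGatesLinAlgGateBlindLogWidthDoors

/-!
# Route ConvexRankGates, crux `LinAlgGateBlind` (stmt-PneNP-10681): UNCONDITIONAL doors at logarithmic atom width — span programs and commutative PERM gates up to `m^{7/8-o(1)}`

Support theorems for the crux (vocabulary of `Theorems/ConvexRankGatesLinAlgGateBlindDefs.lean`). The level-`l` door
theorem `not_computes_clique_of_collapse_level` (`…LevelHost`) at the logarithmic width `L(c,m) = (2c+8)(⌊log₂ m⌋+1)`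
(`logWidth_le_lOf`), the rewiring collapses of `…DoorHost` and the single-gate statements of `…LogWidthDoors` give,
with no hypothesis left, for every `c`, eventually in `m`, that NO circuit with `≤ m^c` gates over `{∧₂, ∨₂} ∪ W`
computes `CLIQUE(m, ⌈m^{1/8}⌉)` for

* `not_computes_clique_of_isOver_spanGateOver_logWidth` — `W` = span-program gates of dimension
  `D ≤ m^{7/8}/(log₂ m)^5` over ANY division ring (was `D ≤ m^{11/16}/(8 log₂ m)`);
* `not_computes_clique_of_isOver_commPerm_logWidth` — `W` = commutative `PERM_d` gates, `log₂ d! ≤ m^{7/8}/(log₂ m)^5`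
  (was `m^{3/4}/2`);
* `not_computes_clique_of_isOver_spanGate_zmod_logWidth` — `W` = `𝔽_p`-span programs of dimension `D`,
  `D log₂ p ≤ m^{7/8}/(log₂ m)^5` (was `m^{3/4}/2`).

Together with `not_computes_clique_of_isOver_perm_logWidth` (`…LogWidthPermCircuit`) every unconditional door of the crux
now sits at the limit `1 - δ = 7/8` of the union-bound method. Sources: Razborov 1985, Alon–Boppana 1987 §3; host,
collapses and covers are the tree's. No new definitions. [folklore]
-/

-- `Summit.PneNP.PneNP.…` duplicates `PneNP` BY DESIGN (single-problem summit).
set_option linter.dupNamespace false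

noncomputable section

namespace Summit.PneNP.PneNP.Theorems

open Finset Filter Literature.Computability.Complexity Razborov
open Summit.PneNP.PneNP.Cruxes.LinAlgGateBlind.DnfInvariantWideGatesSeeSmallCliques

/-- **Monotone circuits with span-program gates of dimension `D ≤ m^{7/8}/(log₂ m)^5` over ANY division ring are blind to
`CLIQUE(m, ⌈m^{1/8}⌉)` (unconditional).** Level-`l` door theorem at `L(c,m)` + `isTermGate_spanGate_collapse` +
`sgAt_spanGateOver_logWidth`. [folklore] -/
theorem not_computes_clique_of_isOver_spanGateOver_logWidth : ∀ (F : Type) [DivisionRing F] (c : ℕ),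
    ∀ᶠ m : ℕ in atTop, ∀ D : ℕ, (D : ℝ) ≤ (m : ℝ) ^ (7 / 8 : ℝ) / Real.logb 2 m ^ 5 →
    ∀ C : Circuit (KEdge m), C.IsOver ({GateFn.and 2, GateFn.or 2} ∪
      {g | ∃ (r : Fin g.1 → Fin D → F) (t : Fin D → F),
        ∀ v, g.2 v = true ↔ t ∈ Submodule.span F (r '' {i | v i = true})}) →
      C.size ≤ m ^ c → ¬ C.Computes (cliqueFn m ⌈(m : ℝ) ^ (1 / 8 : ℝ)⌉₊) := by
  intro F _ c
  filter_upwards [not_computes_clique_of_collapse_level c, sgAt_spanGateOver_logWidth F c, logWidth_le_lOf c]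
    with m hm hP hLl D hD C hC hsize
  refine hm _ (Nat.le_mul_of_pos_right _ (Nat.succ_pos _)) hLl _ _ (fun g hg => ?_) (fun g hg A hA => ?_)
    (hP D hD) C hC hsize
  · obtain ⟨r, t, h⟩ := Set.mem_setOf_eq ▸ hg
    exact monotone_of_span_gate g r t h
  · exact isTermGate_spanGate_collapse m _ D g A hA hg

/-- **Monotone circuits with commutative `PERM_d` gates, `log₂ d! ≤ m^{7/8}/(log₂ m)^5`, are blind to
`CLIQUE(m, ⌈m^{1/8}⌉)` (unconditional).** Level-`l` door theorem at `L(c,m)` + `isTermGate_commPerm_collapse` +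
`sgAt_commPerm_logWidth`. [folklore] -/
theorem not_computes_clique_of_isOver_commPerm_logWidth : ∀ c : ℕ, ∀ᶠ m : ℕ in atTop, ∀ d : ℕ,
    Real.logb 2 (d.factorial) ≤ (m : ℝ) ^ (7 / 8 : ℝ) / Real.logb 2 m ^ 5 →
    ∀ C : Circuit (KEdge m), C.IsOver ({GateFn.and 2, GateFn.or 2} ∪
      {g | ∃ d', d' ≤ d ∧ ∃ (σ : Fin g.1 → Equiv.Perm (Fin d')) (τ : Equiv.Perm (Fin d')),
        (∀ i j, σ i * σ j = σ j * σ i) ∧ ∀ v, g.2 v = true ↔ τ ∈ Subgroup.closure (σ '' {i | v i = true})}) →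
      C.size ≤ m ^ c → ¬ C.Computes (cliqueFn m ⌈(m : ℝ) ^ (1 / 8 : ℝ)⌉₊) := by
  intro c
  filter_upwards [not_computes_clique_of_collapse_level c, sgAt_commPerm_logWidth c, logWidth_le_lOf c]
    with m hm hP hLl d hd C hC hsize
  refine hm _ (Nat.le_mul_of_pos_right _ (Nat.succ_pos _)) hLl _ _ (fun g hg => ?_) (fun g hg A hA => ?_)
    (hP d hd) C hC hsize
  · obtain ⟨d', -, σ, τ, -, h⟩ := Set.mem_setOf_eq ▸ hg
    exact monotone_of_closure_gate g σ τ h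
  · exact isTermGate_commPerm_collapse m _ d g A hA hg

/-- **Monotone circuits with `𝔽_p`-span-program gates of dimension `D`, `D log₂ p ≤ m^{7/8}/(log₂ m)^5`, are blind to
`CLIQUE(m, ⌈m^{1/8}⌉)` (unconditional).** Level-`l` door theorem at `L(c,m)` + `isTermGate_spanGate_collapse` +
`sgAt_spanGate_zmod_logWidth`. [folklore] -/
theorem not_computes_clique_of_isOver_spanGate_zmod_logWidth : ∀ c : ℕ, ∀ᶠ m : ℕ in atTop, ∀ (p D : ℕ), p.Prime →
    (D : ℝ) * Real.logb 2 p ≤ (m : ℝ) ^ (7 / 8 : ℝ) / Real.logb 2 m ^ 5 →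
    ∀ C : Circuit (KEdge m), C.IsOver ({GateFn.and 2, GateFn.or 2} ∪
      {g | ∃ (r : Fin g.1 → Fin D → ZMod p) (t : Fin D → ZMod p),
        ∀ v, g.2 v = true ↔ t ∈ Submodule.span (ZMod p) (r '' {i | v i = true})}) →
      C.size ≤ m ^ c → ¬ C.Computes (cliqueFn m ⌈(m : ℝ) ^ (1 / 8 : ℝ)⌉₊) := by
  intro c
  filter_upwards [not_computes_clique_of_collapse_level c, sgAt_spanGate_zmod_logWidth c, logWidth_le_lOf c]
    with m hm hP hLl p D hp hD C hC hsize
  refine hm _ (Nat.le_mul_of_pos_right _ (Nat.succ_pos _)) hLl _ _ (fun g hg => ?_) (fun g hg A hA => ?_)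
    (hP p D hp hD) C hC hsize
  · obtain ⟨r, t, h⟩ := Set.mem_setOf_eq ▸ hg
    exact monotone_of_span_gate g r t h
  · exact isTermGate_spanGate_collapse m _ D g A hA hg

end Summit.PneNP.PneNP.Theorems

end
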